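import Summits.HubbardSuperconductivity.HubbardSuperconductivity.Theorems.BalabanIRBirEveryGroundStateDenseBright
import Mathlib.MeasureTheory.Measure.Lebesgue.Basic
import HarnessLib

/-!
# Crux `BirEveryGroundState` (item `stmt-HubbardSuperconductivity-2083`): the summable-dark-measure closure and the non-summability normal form

Helper file `--supports stmt-HubbardSuperconductivity-2083`
(`Summit.HubbardSuperconductivity.HubbardSuperconductivity.Theses.BalabanIR.BirEveryGroundState`,
crux 5 of route BalabanIR). It is the measure-theoretic twin of
`…BirEveryGroundStateDenseBright` (Baire category): where that file extracts from a failure of the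
crux dark coupling INTERVALS at infinitely many sides, this one extracts dark coupling sets of
NON-SUMMABLE Lebesgue measure, and dually closes the crux from a summability hypothesis.

Write `D_L(c')` for the set of couplings `U` at which some normalised
`(2⌊(1-δ)L²/2⌋, S^z = 0)`-sector ground state `ψ` of `hubbardTorus 2 L 1 U` is `c' L⁴`-dark,
`Re ⟨ψ, Δ_d† Δ_d ψ⟩ ≤ c' L⁴` (a closed set, `DenseBright.isClosed_darkCouplings`).

* `DarkMeasure.exists_mem_Ioo_forall_notMem_of_tsum_volume_lt` — the covering lemma: countably
  many subsets of `ℝ` whose traces on `(a, b)` have total (outer) Lebesgue measure `< b - a` do not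
  cover `(a, b)` (countable subadditivity).
* `DarkMeasure.exists_forall_bright_of_tsum_volume_dark_lt`,
  `exists_everyGroundStateLRO_of_tsum_volume_dark_lt` — hence, if
  `Σ_{L ≥ L₀ even} |D_L(c') ∩ (a, b)| < b - a`, ONE coupling of `(a, b)` is `c' L⁴`-bright at every
  even side `L ≥ L₀`, and there every admissible ground-state sequence has `d_{x²-y²}` pair-field
  long-range order (the crux's conclusion body verbatim).
* `birEveryGroundState_of_summableDarkMeasure` — **closure.** The crux follows as soon as, on every
  window carrying its average hypothesis, some sub-window `(a, b)`, constant `c' > 0` and threshold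
  `L₀` have `Σ_{L ≥ L₀ even} |D_L(c') ∩ (a, b)| < b - a` — in particular as soon as the dark
  lengths `|D_L(c') ∩ (a, b)|` are summable over the sides (then a tail is small).
* `le_tsum_volume_dark_of_not_birEveryGroundState`,
  `tsum_volume_dark_eq_top_of_not_birEveryGroundState` — **normal form of a counterexample**: if
  the crux fails, then on some doped repulsive window carrying the average bound, for EVERY
  sub-window `(a, b)`, EVERY `c' > 0` and every threshold `L₀`,
  `Σ_{L ≥ L₀ even} |D_L(c') ∩ (a, b)| = ∞`: the dark coupling sets have non-summable measure inside
  every sub-window.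

Compared with the Baire twin: a dark set with non-empty interior has positive measure, so
"non-summable measure in every sub-window" refines "an interval at infinitely many sides" by a
quantitative statement (the wandering dark intervals have infinite total length inside every
sub-window); dually the summability door asks nothing about density and tolerates dark intervals
at every side provided their lengths are summable. Folklore measure theory (countable
subadditivity of Lebesgue outer measure, vanishing tails of convergent series in `ℝ≥0∞`) over the
landed finite-dimensional spectral theory; no definitions, no named facts.
-/

noncomputable section

-- the mandated namespace `Summit.<Summit>.<Problem>.Theorems` repeats `HubbardSuperconductivity`
-- (single-problem summit, D-0017), which the `dupNamespace` linter flags on every declaration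
set_option linter.dupNamespace false

namespace Summit.HubbardSuperconductivity.HubbardSuperconductivity.Theorems

open Matrix Set Filter Topology MeasureTheory
open Literature.Probability.LatticeModels Literature.MathematicalPhysics.QuantumLattice
open Summit.HubbardSuperconductivity.HubbardSuperconductivity.Theses.BalabanIR
open scoped ComplexOrder ENNReal

namespace DarkMeasure

/-! ### The covering lemma -/

/-- **Countable subadditivity as a selection principle.** If countably many subsets `D L ⊆ ℝ`
have traces on `(a, b)` of total outer Lebesgue measure `< b - a = |(a, b)|`, then some point of
`(a, b)` lies in none of them (otherwise `(a, b) ⊆ ⋃_L ((a, b) ∩ D L)` and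
`b - a ≤ Σ_L |(a, b) ∩ D L|`). No measurability is needed. Lebesgue (1902). [folklore] -/
theorem exists_mem_Ioo_forall_notMem_of_tsum_volume_lt {a b : ℝ} (D : ℕ → Set ℝ)
    (h : ∑' L, volume (Set.Ioo a b ∩ D L) < ENNReal.ofReal (b - a)) :
    ∃ U ∈ Set.Ioo a b, ∀ L, U ∉ D L := by
  by_contra hcon
  have hcov : Set.Ioo a b ⊆ ⋃ L, (Set.Ioo a b ∩ D L) := fun U hU => by
    by_contra hU'
    exact hcon ⟨U, hU, fun L hL => hU' (Set.mem_iUnion.2 ⟨L, hU, hL⟩)⟩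
  have h1 : volume (Set.Ioo a b) ≤ ∑' L, volume (Set.Ioo a b ∩ D L) :=
    (measure_mono hcov).trans (measure_iUnion_le _)
  rw [Real.volume_Ioo] at h1
  exact lt_irrefl _ (h1.trans_lt h)

/-- **Tails bounded below ⇒ the series is infinite.** If a series in `ℝ≥0∞` has every tail
`Σ_{L ≥ L₀} f L` bounded below by a fixed `ε > 0`, it diverges (the tails of a convergent series
tend to `0`). [folklore] -/
theorem tsum_eq_top_of_forall_le_tsum_tail {f : ℕ → ℝ≥0∞} {ε : ℝ≥0∞} (hε : ε ≠ 0)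
    (h : ∀ L₀ : ℕ, ε ≤ ∑' L, {L | L₀ ≤ L}.indicator f L) : ∑' L, f L = ⊤ := by
  by_contra hfin
  -- the tails over the complements of `Finset.range L₀` tend to `0`
  have htail := (ENNReal.tendsto_tsum_compl_atTop_zero hfin).comp tendsto_finset_range
  have hev : ∀ᶠ L₀ : ℕ in atTop, (∑' L : {L // L ∉ Finset.range L₀}, f L) < ε :=
    htail (Iio_mem_nhds (pos_iff_ne_zero.2 hε))
  obtain ⟨L₀, hL₀⟩ := hev.exists
  -- but the tail over `{L | L₀ ≤ L}` is the same sum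
  have heq : (∑' L : {L // L ∉ Finset.range L₀}, f L) = ∑' L, {L | L₀ ≤ L}.indicator f L := by
    have hset : {L : ℕ | L ∉ Finset.range L₀} = {L | L₀ ≤ L} := by
      ext L; simp [Finset.mem_range, not_lt]
    rw [← hset]
    exact (tsum_subtype {L : ℕ | L ∉ Finset.range L₀} f)
  exact absurd ((h L₀).trans_eq heq.symm) (not_le.2 hL₀)

/-! ### The Hubbard torus: small total dark measure ⇒ a common bright coupling -/

/-- **Small total dark measure ⇒ one coupling bright at every side.** Fix `δ`, a window `(a, b)`,
a constant `c'` and a threshold `L₀`, and let `D_L(c')` be the set of couplings `U` admitting a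
normalised `(2⌊(1-δ)L²/2⌋, S^z = 0)`-sector ground state `ψ` of `hubbardTorus 2 L 1 U` with
`Re ⟨ψ, Δ_d† Δ_d ψ⟩ ≤ c' L⁴`. If `Σ_{L ≥ L₀ even, L ≠ 0} |D_L(c') ∩ (a, b)| < b - a` (outer Lebesgue
measure), then ONE coupling `U ∈ (a, b)` is `c' L⁴`-bright at EVERY even side `L ≥ L₀`: every
normalised sector ground state there has `c' L⁴ < Re ⟨ψ, Δ_d† Δ_d ψ⟩`
(`exists_mem_Ioo_forall_notMem_of_tsum_volume_lt`). Lebesgue (1902). [folklore] -/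
theorem exists_forall_bright_of_tsum_volume_dark_lt (δ : ℝ) {a b : ℝ} (c' : ℝ) (L₀ : ℕ)
    (h : ∑' L : ℕ, volume (Set.Ioo a b ∩ {U : ℝ | ∃ (_ : NeZero L), L₀ ≤ L ∧ Even L ∧
      ∃ ψ : Fock (Orb (FermionTorus 2 L)),
        IsGroundStateInSector (hubbardTorus 2 L 1 U) (2 * ⌊(1 - δ) * (L : ℝ) ^ 2 / 2⌋₊) 0 ψ ∧
        star ψ ⬝ᵥ ψ = 1 ∧
        (star ψ ⬝ᵥ ((pairField dWaveFormFactor L)ᴴ * pairField dWaveFormFactor L) *ᵥ ψ).re ≤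
          c' * (L : ℝ) ^ 4}) < ENNReal.ofReal (b - a)) :
    ∃ U ∈ Set.Ioo a b, ∀ (L : ℕ) [NeZero L], L₀ ≤ L → Even L →
      ∀ ψ : Fock (Orb (FermionTorus 2 L)),
        IsGroundStateInSector (hubbardTorus 2 L 1 U) (2 * ⌊(1 - δ) * (L : ℝ) ^ 2 / 2⌋₊) 0 ψ →
        star ψ ⬝ᵥ ψ = 1 →
        c' * (L : ℝ) ^ 4 <
          (star ψ ⬝ᵥ ((pairField dWaveFormFactor L)ᴴ * pairField dWaveFormFactor L) *ᵥ ψ).re := by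
  obtain ⟨U, hU, hbr⟩ := exists_mem_Ioo_forall_notMem_of_tsum_volume_lt _ h
  refine ⟨U, hU, fun L _ hL hE ψ hgs h1 => ?_⟩
  by_contra hle
  exact hbr L ⟨‹NeZero L›, hL, hE, ψ, hgs, h1, not_lt.1 hle⟩

end DarkMeasure

/-! ### Small total dark measure ⇒ the crux's conclusion body at one coupling -/

/-- **Small total dark measure ⇒ every-ground-state LRO at one coupling of the window.** Under
the hypothesis of `DarkMeasure.exists_forall_bright_of_tsum_volume_dark_lt` with `c' > 0` and
`δ ≥ -1`, there is a coupling `U ∈ (a, b)` at which EVERY admissible normalised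
`(2⌊(1-δ)L²/2⌋, S^z = 0)`-sector ground-state sequence of `hubbardTorus 2 L 1 U` has `d_{x²-y²}`
pair-field long-range order along the even sides — the verbatim conclusion body of
`Theses.BalabanIR.BirEveryGroundState` (`forall_hasLRO_iff_groundState_bound`, ⇐).
Lebesgue (1902); Scalapino, Phys. Rep. 250 (1995) 329, §2. [folklore] -/
theorem exists_everyGroundStateLRO_of_tsum_volume_dark_lt {δ : ℝ} (hδ : -1 ≤ δ) {a b : ℝ}
    {c' : ℝ} (hc' : 0 < c') (L₀ : ℕ)
    (h : ∑' L : ℕ, volume (Set.Ioo a b ∩ {U : ℝ | ∃ (_ : NeZero L), L₀ ≤ L ∧ Even L ∧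
      ∃ ψ : Fock (Orb (FermionTorus 2 L)),
        IsGroundStateInSector (hubbardTorus 2 L 1 U) (2 * ⌊(1 - δ) * (L : ℝ) ^ 2 / 2⌋₊) 0 ψ ∧
        star ψ ⬝ᵥ ψ = 1 ∧
        (star ψ ⬝ᵥ ((pairField dWaveFormFactor L)ᴴ * pairField dWaveFormFactor L) *ᵥ ψ).re ≤
          c' * (L : ℝ) ^ 4}) < ENNReal.ofReal (b - a)) :
    ∃ U ∈ Set.Ioo a b, ∀ (N : ℕ → ℕ) (ψ : ∀ L, Fock (Orb (FermionTorus 2 L))),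
      (∀ L, Even L → N L = 2 * ⌊(1 - δ) * (L : ℝ) ^ 2 / 2⌋₊ ∧ star (ψ L) ⬝ᵥ ψ L = 1 ∧
        IsGroundStateInSector (hubbardTorus 2 L 1 U) (N L) 0 (ψ L)) →
      HasLongRangeOrder (fun k => halfOpenBox 2 (2 * k))
        (fun k => torusPullback (pairFieldCorr dWaveFormFactor ψ) (2 * k)) := by
  obtain ⟨U, hUab, hU⟩ := DarkMeasure.exists_forall_bright_of_tsum_volume_dark_lt δ c' L₀ h
  exact ⟨U, hUab, (forall_hasLRO_iff_groundState_bound U δ hδ).2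
    ⟨c', hc', L₀, fun L _ hL hE ψ hgs h1 => (hU L hL hE ψ hgs h1).le⟩⟩

/-! ### The closure: summable dark measure ⇒ the crux -/

/-- **`BirEveryGroundState` ⇐ small total dark measure on a sub-window of every window carrying
the average bound.** Suppose that for all data `(δ, U₁, U₂, c)` of the crux and under its
window-average hypothesis there are a sub-window `(a, b)` (`U₁ ≤ a`, `b ≤ U₂`), a constant `c' > 0`
and a threshold `L₀` such that the `c' L⁴`-dark coupling sets `D_L(c')` of the sides (couplings
admitting a normalised `(2⌊(1-δ)L²/2⌋, S^z = 0)`-sector ground state of `hubbardTorus 2 L 1 U`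
with `Re ⟨ψ, Δ_d† Δ_d ψ⟩ ≤ c' L⁴`) satisfy `Σ_{L ≥ L₀ even, L ≠ 0} |D_L(c') ∩ (a, b)| < b - a` — for
instance because the dark lengths `|D_L(c') ∩ (a, b)|` are summable over `L` (pass to a tail).
Then the crux holds: countable subadditivity (`exists_everyGroundStateLRO_of_tsum_volume_dark_lt`)
gives a coupling of `(a, b) ⊆ (U₁, U₂)` bright at every even side `L ≥ L₀`, where every
admissible ground-state sequence has pair-field long-range order. Lebesgue (1902). [folklore] -/
theorem birEveryGroundState_of_summableDarkMeasure
    (h : ∀ (δ U₁ U₂ c : ℝ), δ ∈ Set.Ioo (0:ℝ) (1/2) → 0 < U₁ → U₁ < U₂ → 0 < c →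
      (∀ U ∈ Set.Ioo U₁ U₂, ∃ L₀ : ℕ, ∀ (L : ℕ) [NeZero L], L₀ ≤ L → Even L →
        let N : ℕ := 2 * ⌊(1 - δ) * (L : ℝ) ^ 2 / 2⌋₊
        let H := hubbardTorus 2 L 1 U
        let S := szSector (Λ := FermionTorus 2 L) N 0
        let E₀ := S ⊓ Module.End.eigenspace (Matrix.toLin' H) ((H.minEnergyOn S : ℝ) : ℂ)
        let P := projMatrix (E₀.map (Fock.toEuclidean (ι := Orb (FermionTorus 2 L)) :
          Fock (Orb (FermionTorus 2 L)) →ₗ[ℂ] EuclideanSpace ℂ (Finset (Orb (FermionTorus 2 L)))))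
        c * (L : ℝ) ^ 4 * P.trace.re ≤
          (P * ((pairField dWaveFormFactor L)ᴴ * pairField dWaveFormFactor L)).trace.re) →
      ∃ a b c' : ℝ, U₁ ≤ a ∧ b ≤ U₂ ∧ 0 < c' ∧ ∃ L₀ : ℕ,
        ∑' L : ℕ, volume (Set.Ioo a b ∩ {U : ℝ | ∃ (_ : NeZero L), L₀ ≤ L ∧ Even L ∧
          ∃ ψ : Fock (Orb (FermionTorus 2 L)),
            IsGroundStateInSector (hubbardTorus 2 L 1 U) (2 * ⌊(1 - δ) * (L : ℝ) ^ 2 / 2⌋₊) 0 ψ ∧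
            star ψ ⬝ᵥ ψ = 1 ∧
            (star ψ ⬝ᵥ ((pairField dWaveFormFactor L)ᴴ * pairField dWaveFormFactor L) *ᵥ
              ψ).re ≤ c' * (L : ℝ) ^ 4}) < ENNReal.ofReal (b - a)) :
    BirEveryGroundState := by
  intro δ U₁ U₂ c hδ hU₁ hU₁₂ hc hyp
  obtain ⟨a, b, c', ha, hb, hc', L₀, hsum⟩ := h δ U₁ U₂ c hδ hU₁ hU₁₂ hc hyp
  have hδ' : -1 ≤ δ := by linarith [hδ.1]
  obtain ⟨U, hUab, hLRO⟩ := exists_everyGroundStateLRO_of_tsum_volume_dark_lt hδ' hc' L₀ hsum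
  exact ⟨U, ⟨lt_of_le_of_lt ha hUab.1, lt_of_lt_of_le hUab.2 hb⟩, hLRO⟩

/-! ### The normal form of a counterexample: dark sets of non-summable measure -/

/-- **Normal form of `¬ BirEveryGroundState`: every tail of the dark lengths weighs at least the
sub-window.** If the crux fails then there are data `δ ∈ (0, ½)`, `0 < U₁ < U₂`, `c > 0` such that
(i) the crux's window-average hypothesis holds on `(U₁, U₂)` with constant `c`, and (ii) for every
sub-window `(a, b)` (`U₁ ≤ a`, `b ≤ U₂`), every `c' > 0` and every threshold `L₀`, the `c' L⁴`-dark
coupling sets `D_L(c')` (couplings admitting a normalised `(2⌊(1-δ)L²/2⌋, S^z = 0)`-sector ground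
state of `hubbardTorus 2 L 1 U` with `Re ⟨ψ, Δ_d† Δ_d ψ⟩ ≤ c' L⁴`) satisfy
`b - a ≤ Σ_{L ≥ L₀ even, L ≠ 0} |D_L(c') ∩ (a, b)|`. This is the contrapositive of
`birEveryGroundState_of_summableDarkMeasure`. [folklore] -/
theorem le_tsum_volume_dark_of_not_birEveryGroundState (hS : ¬ BirEveryGroundState) :
    ∃ (δ U₁ U₂ c : ℝ), δ ∈ Set.Ioo (0:ℝ) (1/2) ∧ 0 < U₁ ∧ U₁ < U₂ ∧ 0 < c ∧
      (∀ U ∈ Set.Ioo U₁ U₂, ∃ L₀ : ℕ, ∀ (L : ℕ) [NeZero L], L₀ ≤ L → Even L →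
        let N : ℕ := 2 * ⌊(1 - δ) * (L : ℝ) ^ 2 / 2⌋₊
        let H := hubbardTorus 2 L 1 U
        let S := szSector (Λ := FermionTorus 2 L) N 0
        let E₀ := S ⊓ Module.End.eigenspace (Matrix.toLin' H) ((H.minEnergyOn S : ℝ) : ℂ)
        let P := projMatrix (E₀.map (Fock.toEuclidean (ι := Orb (FermionTorus 2 L)) :
          Fock (Orb (FermionTorus 2 L)) →ₗ[ℂ] EuclideanSpace ℂ (Finset (Orb (FermionTorus 2 L)))))
        c * (L : ℝ) ^ 4 * P.trace.re ≤
          (P * ((pairField dWaveFormFactor L)ᴴ * pairField dWaveFormFactor L)).trace.re) ∧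
      ∀ a b c' : ℝ, U₁ ≤ a → b ≤ U₂ → 0 < c' → ∀ L₀ : ℕ,
        ENNReal.ofReal (b - a) ≤
          ∑' L : ℕ, volume (Set.Ioo a b ∩ {U : ℝ | ∃ (_ : NeZero L), L₀ ≤ L ∧ Even L ∧
            ∃ ψ : Fock (Orb (FermionTorus 2 L)),
              IsGroundStateInSector (hubbardTorus 2 L 1 U) (2 * ⌊(1 - δ) * (L : ℝ) ^ 2 / 2⌋₊) 0 ψ ∧
              star ψ ⬝ᵥ ψ = 1 ∧
              (star ψ ⬝ᵥ ((pairField dWaveFormFactor L)ᴴ * pairField dWaveFormFactor L) *ᵥ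
                ψ).re ≤ c' * (L : ℝ) ^ 4}) := by
  by_contra hcon
  refine hS (birEveryGroundState_of_summableDarkMeasure fun δ U₁ U₂ c hδ hU₁ hU₁₂ hc hyp => ?_)
  by_contra hneg
  refine hcon ⟨δ, U₁, U₂, c, hδ, hU₁, hU₁₂, hc, hyp, fun a b c' ha hb hc' L₀ => ?_⟩
  by_contra hlt
  exact hneg ⟨a, b, c', ha, hb, hc', L₀, not_le.1 hlt⟩

/-- **Normal form of `¬ BirEveryGroundState`: dark sets of NON-SUMMABLE measure in every
sub-window.** If the crux fails then there are data `δ ∈ (0, ½)`, `0 < U₁ < U₂`, `c > 0` with the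
crux's window-average hypothesis on `(U₁, U₂)` such that for every non-trivial sub-window `(a, b)`
(`U₁ ≤ a < b ≤ U₂`), every `c' > 0` and every threshold `L₀`:
`Σ_{L ≥ L₀ even, L ≠ 0} |D_L(c') ∩ (a, b)| = ∞`, `D_L(c')` the `c' L⁴`-dark coupling set of side `L`
(couplings admitting a normalised `(2⌊(1-δ)L²/2⌋, S^z = 0)`-sector ground state of
`hubbardTorus 2 L 1 U` with `Re ⟨ψ, Δ_d† Δ_d ψ⟩ ≤ c' L⁴`). Indeed by
`le_tsum_volume_dark_of_not_birEveryGroundState` every tail of this series is `≥ b - a > 0`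
(`DarkMeasure.tsum_eq_top_of_forall_le_tsum_tail`). Since a dark set with non-empty interior has
positive length, this refines the dark-interval normal form
`exists_darkInterval_of_not_birEveryGroundState`: inside every sub-window the dark couplings have
infinite total length over the sides. [folklore] -/
theorem tsum_volume_dark_eq_top_of_not_birEveryGroundState (hS : ¬ BirEveryGroundState) :
    ∃ (δ U₁ U₂ c : ℝ), δ ∈ Set.Ioo (0:ℝ) (1/2) ∧ 0 < U₁ ∧ U₁ < U₂ ∧ 0 < c ∧
      (∀ U ∈ Set.Ioo U₁ U₂, ∃ L₀ : ℕ, ∀ (L : ℕ) [NeZero L], L₀ ≤ L → Even L →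
        let N : ℕ := 2 * ⌊(1 - δ) * (L : ℝ) ^ 2 / 2⌋₊
        let H := hubbardTorus 2 L 1 U
        let S := szSector (Λ := FermionTorus 2 L) N 0
        let E₀ := S ⊓ Module.End.eigenspace (Matrix.toLin' H) ((H.minEnergyOn S : ℝ) : ℂ)
        let P := projMatrix (E₀.map (Fock.toEuclidean (ι := Orb (FermionTorus 2 L)) :
          Fock (Orb (FermionTorus 2 L)) →ₗ[ℂ] EuclideanSpace ℂ (Finset (Orb (FermionTorus 2 L)))))
        c * (L : ℝ) ^ 4 * P.trace.re ≤
          (P * ((pairField dWaveFormFactor L)ᴴ * pairField dWaveFormFactor L)).trace.re) ∧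
      ∀ a b c' : ℝ, U₁ ≤ a → a < b → b ≤ U₂ → 0 < c' → ∀ L₀ : ℕ,
        ∑' L : ℕ, volume (Set.Ioo a b ∩ {U : ℝ | ∃ (_ : NeZero L), L₀ ≤ L ∧ Even L ∧
          ∃ ψ : Fock (Orb (FermionTorus 2 L)),
            IsGroundStateInSector (hubbardTorus 2 L 1 U) (2 * ⌊(1 - δ) * (L : ℝ) ^ 2 / 2⌋₊) 0 ψ ∧
            star ψ ⬝ᵥ ψ = 1 ∧
            (star ψ ⬝ᵥ ((pairField dWaveFormFactor L)ᴴ * pairField dWaveFormFactor L) *ᵥ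
              ψ).re ≤ c' * (L : ℝ) ^ 4}) = ⊤ := by
  obtain ⟨δ, U₁, U₂, c, hδ, hU₁, hU₁₂, hc, hyp, htail⟩ :=
    le_tsum_volume_dark_of_not_birEveryGroundState hS
  refine ⟨δ, U₁, U₂, c, hδ, hU₁, hU₁₂, hc, hyp, fun a b c' ha hab hb hc' L₀ => ?_⟩
  have hε : ENNReal.ofReal (b - a) ≠ 0 := by
    rw [Ne, ENNReal.ofReal_eq_zero, not_le]; linarith
  refine DarkMeasure.tsum_eq_top_of_forall_le_tsum_tail hε fun L₁ => ?_
  -- the tail beyond `L₁` dominates the series with threshold `max L₀ L₁`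
  refine (htail a b c' ha hb hc' (max L₀ L₁)).trans (ENNReal.tsum_le_tsum fun L => ?_)
  by_cases hL : L₁ ≤ L
  · rw [Set.indicator_of_mem (show L ∈ {L | L₁ ≤ L} from hL)]
    refine measure_mono (Set.inter_subset_inter_right _ fun U hU => ?_)
    obtain ⟨hLne, hLL, hE, hψ⟩ := hU
    exact ⟨hLne, le_of_max_le_left hLL, hE, hψ⟩
  · -- below `L₁` the set with threshold `max L₀ L₁` is empty
    rw [Set.indicator_of_notMem (show L ∉ {L | L₁ ≤ L} from hL)]
    refine (measure_mono fun U hU => ?_).trans_eq (measure_empty (μ := (volume : Measure ℝ)))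
    obtain ⟨_, hLL, -⟩ := hU.2
    exact hL (le_of_max_le_right hLL)

end Summit.HubbardSuperconductivity.HubbardSuperconductivity.Theorems
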